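import Literature.Analysis.FluidPDE.EulerReynolds
import Literature.Analysis.FluidPDE.NavierStokesConcentrationTools
import Literature.Analysis.FunctionSpaces.TorusCommutatorAllOrders
import Literature.Analysis.FunctionSpaces.TorusSpaceTimeKernel
import Literature.Analysis.FunctionSpaces.TorusLerayHelmholtz
import HarnessLib

/-!
# Mollifying an Euler–Reynolds triple in space (BDSV (2.10))

Serves the discharge of `Literature.Analysis.FluidPDE.BDSV.mollificationStage`
(`OnsagerBDSVThreeStages`; Buckmaster–De Lellis–Székelyhidi–Vicol, arXiv:1701.08678, §2.4): if
`(v, p, R̊)` is a classical Euler–Reynolds triple on `[0,T] × T^d` (`Torus.IsEulerReynoldsOn`),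
then so is its spatial mollification at scale `0 < ε ≤ 1/4` by the standard kernel
`k_ε = Torus.kernel ε`,

  `v_ℓ = k_ε ⋆ v`, `R̊_ℓ = k_ε ⋆ R̊ - C̊`, `p_ℓ = k_ε ⋆ p + (tr C - ∫ tr C)/d`,
  `C = k_ε ⋆ (v ⊗ v) - v_ℓ ⊗ v_ℓ` (`Torus.mollTensorCommutator`, columns `B_ε(vⱼ, v)`),

(`Torus.IsEulerReynoldsOn.mollify`, with `Torus.mollifyVelocity`, `Torus.mollifyPressure`, `Torus.mollifyStress`). This is
BDSV's display following (2.10)′ ("`v_ℓ := v_q * ψ_ℓ`, `R̊_ℓ := R̊_q * ψ_ℓ + (v_q ⊗̊ v_q) * ψ_ℓ - v_ℓ ⊗̊ v_ℓ`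
… These functions obey the equation (2.10) … in view of (2.2)"), with the sign of the commutator
term as forced by (2.10) (the printed `+` is a slip, noted in the docstring of
`BDSV.mollificationStage`), and the trace part of `C` put into the pressure, normalised to zero
mean (`∫ p_ℓ = 0`, the constraint of `Torus.IsEulerReynoldsOn`). Contents:

* tensor algebra by columns: `Torus.tensorTrace`, `Torus.traceless` (traceless part of a general
  tensor field; the tree's `Torus.tracelessSq v` is the special case `S = v ⊗ v`),
  `div (S - S')`, `div S̊ = div S - ∇(tr S/d)` (`Torus.tensorDivergence_traceless`), smoothness
  of tensor fields componentwise;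
* mollification of vector/tensor fields componentwise (`Torus.convolution_apply_tensor`,
  `Torus.convolution_apply_euclidean`), `div (θ ⋆ S) = θ ⋆ div S`, `div (θ ⋆ v) = θ ⋆ div v`,
  `Torus.IsDivFree.convolution` (vector-valued-convolution form of `IsDivFree.vecConv`);
* the commutator tensor, its entries `B_ε(vᵢ, vⱼ)`, symmetry and smoothness;
  **the momentum identity at a fixed time** `Torus.mollified_momentum_identity`:
  `k_ε ⋆ a + (v_ℓ·∇)v_ℓ + ∇(k_ε ⋆ p + tr C/d) = div (k_ε ⋆ R̊ - C̊)` whenever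
  `a + (v·∇)v + ∇p = div R̊` and `div v = 0` (mollify the equation, `(v·∇)v = div (v ⊗ v)` for
  both divergence-free fields, split `C = C̊ + (tr C/d) Id`);
* joint space–time smoothness of the constructed fields (slice-wise convolution on the closed
  time interval: `TorusSpaceTimeKernel`; the time-only mean: `IsSmoothSpaceTimeOn.integral_const`),
  `∂ₜ(k_ε ⋆ v) = k_ε ⋆ ∂ₜv` (`timeDerivWithin_convolution_Icc`), and the theorem.

## Mathlib / tree search

Reused, not restated: `Torus.tensorProd` with `div (v ⊗ v) = (v·∇)v + (div v) v`
(`tensorDivergence_tensorProd`), `tensorDivergence_smul_single`, `gradient_add_apply`,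
`IsSmoothSpaceTimeOn.contDiffOn_integral` / `.integral_const` (`NavierStokesConcentrationTools`);
`IsSmoothSpaceTimeOn.convolution`, `timeDerivWithin_convolution_Icc` (`TorusSpaceTimeKernel`);
`gradient_convolution`, `partialDeriv_convolution`, `convolution_finset_sum_right`
(`TorusConvolution`); `fderiv_sub` (`TorusLerayHelmholtz`); `mollCommutator` and the linearity of
`θ ⋆ ·` (`TorusCommutatorAllOrders`). Inside `namespace …FluidPDE.Torus` the bare names
`IsSmoothSpaceTimeOn`, `partialDeriv` denote the Euclidean notions of `FluidPDE/`, so the torus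
ones are written `FunctionSpaces.Torus.…` throughout. Nothing here restates
`Torus.IsEulerReynoldsOn` or a problem statement.

## References

* T. Buckmaster, C. De Lellis, L. Székelyhidi Jr., V. Vicol, *Onsager's conjecture for admissible
  weak solutions*, Comm. Pure Appl. Math. 72 (2019) = arXiv:1701.08678, §2.1 (2.2), §2.4 (2.10).
-/

open MeasureTheory Set Filter
open scoped Convolution ContDiff ENNReal InnerProductSpace

noncomputable section

namespace Literature.Analysis.FluidPDE

namespace Torus

open FunctionSpaces.Torus (stLift lift kernel IsSmooth IsContDiff mollCommutator IsDivFree)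

variable {d : Type*} [Fintype d] [DecidableEq d]

/-! ## Tensor algebra: products, trace, traceless part -/

section TensorAlgebra

omit [DecidableEq d] in
/-- The trace `tr S(x) = ∑ᵢ Sᵢᵢ(x)` of a tensor field stored by columns. [folklore] -/
def tensorTrace (S : UnitAddTorus d → d → EuclideanSpace ℝ d) (x : UnitAddTorus d) : ℝ := ∑ i, S x i i

/-- The traceless part `S̊ = S - (tr S / d) Id` of a tensor field stored by columns (BDSV §2.4:
`f ⊗̊ g` "the traceless part of the tensor `f ⊗ g`"). [cite: BuckmasterEtAl2018, §2.4] -/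
def traceless (S : UnitAddTorus d → d → EuclideanSpace ℝ d) : UnitAddTorus d → d → EuclideanSpace ℝ d :=
  fun x j => S x j - (tensorTrace S x / Fintype.card d) • EuclideanSpace.single j (1 : ℝ)

/-- Unfolding lemma for `traceless`. [folklore] -/
theorem traceless_apply (S : UnitAddTorus d → d → EuclideanSpace ℝ d) (x : UnitAddTorus d) (j : d) :
    traceless S x j = S x j - (tensorTrace S x / Fintype.card d) • EuclideanSpace.single j (1 : ℝ) :=
  rfl

/-- The traceless part is trace free: `∑ᵢ S̊ᵢᵢ = 0`. [folklore] -/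
theorem sum_traceless_apply_apply (S : UnitAddTorus d → d → EuclideanSpace ℝ d) (x : UnitAddTorus d) :
    ∑ i, traceless S x i i = 0 := by
  simp only [traceless_apply, PiLp.sub_apply, PiLp.smul_apply, EuclideanSpace.single,
    PiLp.single_apply, if_true, smul_eq_mul, mul_one, Finset.sum_sub_distrib, Finset.sum_const,
    Finset.card_univ, nsmul_eq_mul]
  rw [← tensorTrace]
  rcases Nat.eq_zero_or_pos (Fintype.card d) with h | h
  · have : IsEmpty d := Fintype.card_eq_zero_iff.1 h
    simp [tensorTrace]
  · rw [mul_div_cancel₀ _ (by exact_mod_cast h.ne'), sub_self]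

/-- The traceless part of a symmetric tensor is symmetric. [folklore] -/
theorem traceless_symm {S : UnitAddTorus d → d → EuclideanSpace ℝ d} {x : UnitAddTorus d}
    (hS : ∀ i j, S x i j = S x j i) (i j : d) : traceless S x i j = traceless S x j i := by
  simp only [traceless_apply, PiLp.sub_apply, PiLp.smul_apply, EuclideanSpace.single,
    PiLp.single_apply]
  rw [hS i j]
  by_cases h : i = j
  · subst h; rfl
  · rw [if_neg h, if_neg (Ne.symm h)]

omit [DecidableEq d] in
/-- Smoothness of tensor fields is componentwise (columns). [folklore] -/
theorem isSmooth_tensor_iff {S : UnitAddTorus d → d → EuclideanSpace ℝ d} :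
    IsSmooth S ↔ ∀ j, IsSmooth fun x => S x j :=
  contDiff_pi

omit [DecidableEq d] in
/-- A tensor field with smooth columns is smooth. [folklore] -/
theorem isSmooth_tensor {S : UnitAddTorus d → d → EuclideanSpace ℝ d} (h : ∀ j, IsSmooth fun x => S x j) : IsSmooth S :=
  isSmooth_tensor_iff.2 h

omit [DecidableEq d] in
/-- Smoothness of vector fields is componentwise. [folklore] -/
theorem isSmooth_euclidean_iff {v : UnitAddTorus d → EuclideanSpace ℝ d} :
    IsSmooth v ↔ ∀ j, IsSmooth fun x => v x j :=
  contDiff_piLp (p := 2)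

omit [DecidableEq d] in
/-- The trace of a smooth tensor field is smooth. [folklore] -/
theorem _root_.Literature.Analysis.FunctionSpaces.Torus.IsSmooth.tensorTrace {S : UnitAddTorus d → d → EuclideanSpace ℝ d}
    (hS : IsSmooth S) : IsSmooth (tensorTrace S) :=
  ContDiff.sum fun i _ => (hS.column i).apply i

/-- The traceless part of a smooth tensor field is smooth. [folklore] -/
theorem _root_.Literature.Analysis.FunctionSpaces.Torus.IsSmooth.traceless {S : UnitAddTorus d → d → EuclideanSpace ℝ d}
    (hS : IsSmooth S) : IsSmooth (traceless S) :=
  isSmooth_tensor fun j => (hS.column j).sub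
    (ContDiff.smul (ContDiff.div_const hS.tensorTrace _) contDiff_const)

/-- `div (S - S') = div S - div S'` for smooth tensor fields. [folklore] -/
theorem tensorDivergence_sub {S S' : UnitAddTorus d → d → EuclideanSpace ℝ d} (hS : IsSmooth S) (hS' : IsSmooth S')
    (x : UnitAddTorus d) :
    tensorDivergence (fun y j => S y j - S' y j) x = tensorDivergence S x - tensorDivergence S' x := by
  unfold tensorDivergence
  rw [← Finset.sum_sub_distrib]
  refine Finset.sum_congr rfl fun j _ => ?_
  have h1 : IsContDiff 1 fun y => S y j := (hS.column j).isContDiff (by simp)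
  have h2 : IsContDiff 1 fun y => S' y j := (hS'.column j).isContDiff (by simp)
  have h12 : IsContDiff 1 ((fun y => S y j) - fun y => S' y j) := ContDiff.sub h1 h2
  show FunctionSpaces.Torus.partialDeriv j ((fun y => S y j) - fun y => S' y j) x = _
  rw [FunctionSpaces.Torus.partialDeriv_eq_fderiv_apply h12,
    FunctionSpaces.Torus.partialDeriv_eq_fderiv_apply h1,
    FunctionSpaces.Torus.partialDeriv_eq_fderiv_apply h2, FunctionSpaces.Torus.fderiv_sub h1 h2]
  rfl

/-- **`div S̊ = div S - ∇(tr S / d)`** for smooth tensor fields. [folklore] -/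
theorem tensorDivergence_traceless {S : UnitAddTorus d → d → EuclideanSpace ℝ d} (hS : IsSmooth S) (x : UnitAddTorus d) :
    tensorDivergence (traceless S) x =
      tensorDivergence S x - FunctionSpaces.Torus.gradient (fun y => tensorTrace S y / Fintype.card d) x := by
  have hθ : IsSmooth fun y => tensorTrace S y / Fintype.card d := ContDiff.div_const hS.tensorTrace _
  have hI : IsSmooth fun (y : UnitAddTorus d) (j : d) =>
      (tensorTrace S y / Fintype.card d) • EuclideanSpace.single j (1 : ℝ) :=
    isSmooth_tensor fun j => hθ.smul' (FunctionSpaces.Torus.isSmooth_const _)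
  rw [show traceless S = fun y j => S y j -
      (fun y j => (tensorTrace S y / Fintype.card d) • EuclideanSpace.single j (1 : ℝ)) y j from rfl,
    tensorDivergence_sub hS hI, tensorDivergence_smul_single (hθ.isContDiff (by simp))]

end TensorAlgebra

/-! ## Mollification of vector and tensor fields: componentwise identities -/

section ConvolutionComponents

variable {θ : UnitAddTorus d → ℝ}

omit [DecidableEq d] in
/-- Components of a mollified tensor field: `(θ ⋆ S)(x) eⱼ = (θ ⋆ S eⱼ)(x)`. [folklore] -/
theorem convolution_apply_tensor (hθ : Integrable θ volume) {S : UnitAddTorus d → d → EuclideanSpace ℝ d}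
    (hS : Continuous S) (x : UnitAddTorus d) (j : d) :
    (θ ⋆ S) x j = (θ ⋆ fun y => S y j) x := by
  rw [convolution_lsmul, convolution_lsmul]
  have h := (ContinuousLinearMap.proj (R := ℝ) (φ := fun _ : d => EuclideanSpace ℝ d) j).integral_comp_comm
    (FunctionSpaces.Torus.integrable_smul_comp_sub hθ hS x)
  simpa using h.symm

omit [DecidableEq d] in
/-- Components of a mollified vector field: `(θ ⋆ v)ⱼ = θ ⋆ vⱼ`. [folklore] -/
theorem convolution_apply_euclidean (hθ : Integrable θ volume) {v : UnitAddTorus d → EuclideanSpace ℝ d}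
    (hv : Continuous v) (x : UnitAddTorus d) (j : d) :
    (θ ⋆ v) x j = (θ ⋆ fun y => v y j) x := by
  rw [convolution_lsmul, convolution_lsmul]
  have h := (EuclideanSpace.proj j : EuclideanSpace ℝ d →L[ℝ] ℝ).integral_comp_comm
    (FunctionSpaces.Torus.integrable_smul_comp_sub hθ hv x)
  simpa using h.symm

/-- **Mollification commutes with the tensor divergence**: `div (θ ⋆ S) = θ ⋆ div S` for
`θ ∈ L¹` and smooth `S`. [folklore] -/
theorem tensorDivergence_convolution (hθ : Integrable θ volume) {S : UnitAddTorus d → d → EuclideanSpace ℝ d}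
    (hS : IsSmooth S) (x : UnitAddTorus d) :
    tensorDivergence (θ ⋆ S) x = (θ ⋆ tensorDivergence S) x := by
  unfold tensorDivergence
  rw [FunctionSpaces.Torus.convolution_finset_sum_right hθ _
    (fun j _ => ((hS.column j).partialDeriv j).continuous)]
  refine Finset.sum_congr rfl fun j _ => ?_
  have h : (fun y => (θ ⋆ S) y j) = θ ⋆ fun y => S y j :=
    funext fun y => convolution_apply_tensor hθ hS.continuous y j
  rw [h, FunctionSpaces.Torus.partialDeriv_convolution hθ (hS.column j)]

/-- **Mollification commutes with the divergence**: `div (θ ⋆ v) = θ ⋆ div v`. [folklore] -/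
theorem divergence_convolution (hθ : Integrable θ volume) {v : UnitAddTorus d → EuclideanSpace ℝ d} (hv : IsSmooth v)
    (x : UnitAddTorus d) :
    FunctionSpaces.Torus.divergence (θ ⋆ v) x = (θ ⋆ FunctionSpaces.Torus.divergence v) x := by
  unfold FunctionSpaces.Torus.divergence
  rw [FunctionSpaces.Torus.convolution_finset_sum_right hθ _
    (fun j _ => ((hv.apply j).partialDeriv j).continuous)]
  refine Finset.sum_congr rfl fun j _ => ?_
  have h : (fun y => (θ ⋆ v) y j) = θ ⋆ fun y => v y j :=
    funext fun y => convolution_apply_euclidean hθ hv.continuous y j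
  rw [h, FunctionSpaces.Torus.partialDeriv_convolution hθ (hv.apply j)]

/-- Mollifying a smooth divergence-free field gives a divergence-free field. [folklore] -/
theorem _root_.Literature.Analysis.FunctionSpaces.Torus.IsDivFree.convolution (hθ : Integrable θ volume)
    {v : UnitAddTorus d → EuclideanSpace ℝ d} (hv : IsSmooth v) (hdiv : IsDivFree v) : IsDivFree (θ ⋆ v) := by
  intro x
  rw [divergence_convolution hθ hv, show FunctionSpaces.Torus.divergence v = fun _ => (0 : ℝ) from
    funext hdiv]
  simp [convolution_lsmul]

end ConvolutionComponents

/-! ## The mollified commutator tensor -/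

section CommutatorTensor

variable {ε : ℝ}

omit [DecidableEq d] in
/-- **The mollified commutator tensor** `C_ε(v) = k_ε ⋆ (v ⊗ v) - (k_ε ⋆ v) ⊗ (k_ε ⋆ v)`, by
columns `C_ε(v) eⱼ = B_ε(vⱼ, v)` (`Torus.mollCommutator`); its traceless part is BDSV's
`(v ⊗̊ v) * ψ_ℓ - v_ℓ ⊗̊ v_ℓ` (§2.4). [cite: BuckmasterEtAl2018, §2.4] -/
def mollTensorCommutator (ε : ℝ) (v : UnitAddTorus d → EuclideanSpace ℝ d) : UnitAddTorus d → d → EuclideanSpace ℝ d :=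
  fun x j => mollCommutator ε (fun y => v y j) v x

omit [Fintype d] [DecidableEq d] in
/-- Components of a continuous vector field are continuous. [folklore] -/
theorem continuous_euclidean_apply {v : UnitAddTorus d → EuclideanSpace ℝ d} (hv : Continuous v) (i : d) :
    Continuous fun y => v y i :=
  (EuclideanSpace.proj i : EuclideanSpace ℝ d →L[ℝ] ℝ).continuous.comp hv

omit [DecidableEq d] in
/-- `C_ε(v) = k_ε ⋆ (v ⊗ v) - (k_ε ⋆ v) ⊗ (k_ε ⋆ v)` componentwise (`0 < ε ≤ 1/4`). [folklore] -/
theorem mollTensorCommutator_apply (hε : 0 < ε) (hε' : ε ≤ 1 / 4) {v : UnitAddTorus d → EuclideanSpace ℝ d}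
    (hv : Continuous v) (x : UnitAddTorus d) (j : d) :
    mollTensorCommutator ε v x j =
      (kernel ε ⋆ tensorProd v v) x j - tensorProd (kernel ε ⋆ v) (kernel ε ⋆ v) x j := by
  have hκ : Integrable (kernel (d := d) ε) volume :=
    (FunctionSpaces.Torus.continuous_kernel hε hε').integrable_unitAddTorus
  have hvv : Continuous (tensorProd v v) := continuous_pi fun j => (continuous_euclidean_apply hv j).smul hv
  rw [mollTensorCommutator, FunctionSpaces.Torus.mollCommutator_apply, convolution_apply_tensor hκ hvv x j]
  simp only [tensorProd]
  rw [convolution_apply_euclidean hκ hv x j]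

omit [DecidableEq d] in
/-- Entries of the commutator tensor: `(C_ε(v))ᵢⱼ = B_ε(vᵢ, vⱼ)` (`0 < ε ≤ 1/4`). [folklore] -/
theorem mollTensorCommutator_apply_apply (hε : 0 < ε) (hε' : ε ≤ 1 / 4) {v : UnitAddTorus d → EuclideanSpace ℝ d}
    (hv : Continuous v) (x : UnitAddTorus d) (i j : d) :
    mollTensorCommutator ε v x i j = mollCommutator ε (fun y => v y i) (fun y => v y j) x := by
  have hκ : Integrable (kernel (d := d) ε) volume :=
    (FunctionSpaces.Torus.continuous_kernel hε hε').integrable_unitAddTorus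
  rw [mollTensorCommutator, FunctionSpaces.Torus.mollCommutator_apply,
    FunctionSpaces.Torus.mollCommutator_apply, PiLp.sub_apply, PiLp.smul_apply,
    convolution_apply_euclidean hκ (v := fun y => v y i • v y) ((continuous_euclidean_apply hv i).smul hv) x j,
    convolution_apply_euclidean hκ hv x j]
  simp only [PiLp.smul_apply, smul_eq_mul]

omit [DecidableEq d] in
/-- The real commutator is symmetric: `B_ε(f, g) = B_ε(g, f)`. [folklore] -/
theorem mollCommutator_comm (ε : ℝ) (f g : UnitAddTorus d → ℝ) :
    mollCommutator ε f g = mollCommutator ε g f := by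
  funext x
  simp only [FunctionSpaces.Torus.mollCommutator_apply, smul_eq_mul, mul_comm (f _) (g _),
    mul_comm ((kernel ε ⋆ f) x)]

omit [DecidableEq d] in
/-- The commutator tensor is symmetric (`0 < ε ≤ 1/4`). [folklore] -/
theorem mollTensorCommutator_symm (hε : 0 < ε) (hε' : ε ≤ 1 / 4) {v : UnitAddTorus d → EuclideanSpace ℝ d}
    (hv : Continuous v) (x : UnitAddTorus d) (i j : d) :
    mollTensorCommutator ε v x i j = mollTensorCommutator ε v x j i := by
  rw [mollTensorCommutator_apply_apply hε hε' hv, mollTensorCommutator_apply_apply hε hε' hv,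
    mollCommutator_comm]

omit [DecidableEq d] in
/-- The commutator tensor of a smooth field is smooth (`0 < ε ≤ 1/4`). [folklore] -/
theorem _root_.Literature.Analysis.FunctionSpaces.Torus.IsSmooth.mollTensorCommutator (hε : 0 < ε)
    (hε' : ε ≤ 1 / 4) {v : UnitAddTorus d → EuclideanSpace ℝ d} (hv : IsSmooth v) : IsSmooth (mollTensorCommutator ε v) :=
  isSmooth_tensor fun j => FunctionSpaces.Torus.isSmooth_mollCommutator hε hε' (hv.apply j) hv

end CommutatorTensor

/-! ## The momentum identity of the mollified fields (fixed time) -/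

section Momentum

variable {ε : ℝ}

omit [DecidableEq d] in
/-- `∇(φ - c) = ∇φ` for a constant `c`. [folklore] -/
theorem gradient_sub_const (φ : UnitAddTorus d → ℝ) (c : ℝ) (x : UnitAddTorus d) :
    FunctionSpaces.Torus.gradient (fun y => φ y - c) x = FunctionSpaces.Torus.gradient φ x := by
  unfold FunctionSpaces.Torus.gradient _root_.gradient
  rw [show FunctionSpaces.Torus.liftAt (fun y => φ y - c) x =
      fun v => FunctionSpaces.Torus.liftAt φ x v - c from rfl, fderiv_sub_const]

/-- **The momentum identity of the mollified fields.** Let `(v, p, R)` be smooth on `T^d` with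
`div v = 0` and `a + (v·∇)v + ∇p = div R` for a field `a` (at a fixed time, `a = ∂ₜv`). Then,
with `k_ε` the standard mollifier (`0 < ε ≤ 1/4`), `v_ε = k_ε ⋆ v`, `C = C_ε(v)`:
`k_ε ⋆ a + (v_ε·∇)v_ε + ∇(k_ε ⋆ p + tr C/d) = div (k_ε ⋆ R - C̊)` — mollify the equation
(`k_ε ⋆` commutes with `div`, `∇`), write `(v·∇)v = div (v ⊗ v)`, `(v_ε·∇)v_ε = div (v_ε ⊗ v_ε)`
(both fields being divergence free) and split `C = C̊ + (tr C/d) Id` (BDSV §2.4, (2.10):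
"These functions obey the equation … in view of (2.2)"). [cite: BuckmasterEtAl2018, §2.4 (2.10)] -/
theorem mollified_momentum_identity (hε : 0 < ε) (hε' : ε ≤ 1 / 4) {v a : UnitAddTorus d → EuclideanSpace ℝ d}
    {p : UnitAddTorus d → ℝ} {R : UnitAddTorus d → d → EuclideanSpace ℝ d} (hv : IsSmooth v)
    (hp : IsSmooth p) (hR : IsSmooth R) (hdiv : IsDivFree v)
    (hmom : ∀ x, a x + FunctionSpaces.Torus.convect v v x + FunctionSpaces.Torus.gradient p x =
      tensorDivergence R x) (x : UnitAddTorus d) :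
    (kernel ε ⋆ a) x + FunctionSpaces.Torus.convect (kernel ε ⋆ v) (kernel ε ⋆ v) x +
      FunctionSpaces.Torus.gradient (fun y => (kernel ε ⋆ p) y +
        tensorTrace (mollTensorCommutator ε v) y / Fintype.card d) x =
      tensorDivergence (fun y j => (kernel ε ⋆ R) y j - traceless (mollTensorCommutator ε v) y j) x := by
  have hκc : Continuous (kernel (d := d) ε) := FunctionSpaces.Torus.continuous_kernel hε hε'
  have hκ : Integrable (kernel (d := d) ε) volume := hκc.integrable_unitAddTorus
  have hv1 : IsContDiff 1 v := hv.isContDiff (by simp)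
  have hvε : IsSmooth (kernel ε ⋆ v) := FunctionSpaces.Torus.isSmooth_convolution hκ hv
  have hvε1 : IsContDiff 1 (kernel ε ⋆ v) := hvε.isContDiff (by simp)
  have hRε : IsSmooth (kernel ε ⋆ R) := FunctionSpaces.Torus.isSmooth_convolution hκ hR
  have hvv : IsSmooth (tensorProd v v) := hv.tensorProd hv
  have hC : IsSmooth (mollTensorCommutator ε v) := hv.mollTensorCommutator hε hε'
  -- `a = div R - div (v ⊗ v) - ∇p`
  have ha' : a = fun y => tensorDivergence R y - tensorDivergence (tensorProd v v) y -
      FunctionSpaces.Torus.gradient p y := by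
    funext y
    have h := hmom y
    rw [tensorDivergence_tensorProd hv hv, hdiv y, zero_smul, add_zero]
    rw [← h]; abel
  -- mollify: `k_ε ⋆ a = div (k_ε ⋆ R) - div (k_ε ⋆ (v ⊗ v)) - ∇(k_ε ⋆ p)`
  have h1 : (kernel ε ⋆ a) x = tensorDivergence (kernel ε ⋆ R) x -
      tensorDivergence (kernel ε ⋆ tensorProd v v) x - FunctionSpaces.Torus.gradient (kernel ε ⋆ p) x := by
    rw [ha', FunctionSpaces.Torus.convolution_sub_sub_right hκ hR.tensorDivergence.continuous
        hvv.tensorDivergence.continuous hp.gradient.continuous,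
      tensorDivergence_convolution hκ hR, tensorDivergence_convolution hκ hvv,
      FunctionSpaces.Torus.gradient_convolution hκ hp]
  -- `(v_ε·∇)v_ε = div (v_ε ⊗ v_ε)`
  have h2 : FunctionSpaces.Torus.convect (kernel ε ⋆ v) (kernel ε ⋆ v) x =
      tensorDivergence (tensorProd (kernel ε ⋆ v) (kernel ε ⋆ v)) x := by
    rw [tensorDivergence_tensorProd hvε hvε, (hdiv.convolution hκ hv) x, zero_smul, add_zero]
  -- `∇(k_ε ⋆ p + tr C/d) = ∇(k_ε ⋆ p) + ∇(tr C/d)`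
  have hθ : IsSmooth fun y => tensorTrace (mollTensorCommutator ε v) y / Fintype.card d :=
    ContDiff.div_const hC.tensorTrace _
  have h3 : FunctionSpaces.Torus.gradient (fun y => (kernel ε ⋆ p) y +
        tensorTrace (mollTensorCommutator ε v) y / Fintype.card d) x =
      FunctionSpaces.Torus.gradient (kernel ε ⋆ p) x +
        FunctionSpaces.Torus.gradient (fun y => tensorTrace (mollTensorCommutator ε v) y / Fintype.card d) x :=
    gradient_add_apply ((FunctionSpaces.Torus.isSmooth_convolution hκ hp).isContDiff (by simp))
      (hθ.isContDiff (by simp)) x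
  -- `div (k_ε ⋆ R - C̊) = div (k_ε ⋆ R) - div C + ∇(tr C/d)`, `div C = div (k_ε ⋆ (v⊗v)) - div (v_ε ⊗ v_ε)`
  have h4 : tensorDivergence (fun y j => (kernel ε ⋆ R) y j - traceless (mollTensorCommutator ε v) y j) x =
      tensorDivergence (kernel ε ⋆ R) x - (tensorDivergence (mollTensorCommutator ε v) x -
        FunctionSpaces.Torus.gradient (fun y => tensorTrace (mollTensorCommutator ε v) y / Fintype.card d) x) := by
    rw [tensorDivergence_sub hRε hC.traceless, tensorDivergence_traceless hC]
  have h5 : tensorDivergence (mollTensorCommutator ε v) x =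
      tensorDivergence (kernel ε ⋆ tensorProd v v) x -
        tensorDivergence (tensorProd (kernel ε ⋆ v) (kernel ε ⋆ v)) x := by
    rw [← tensorDivergence_sub (FunctionSpaces.Torus.isSmooth_convolution hκ hvv) (hvε.tensorProd hvε)]
    congr 1
    funext y j
    exact mollTensorCommutator_apply hε hε' hv.continuous y j
  rw [h1, h2, h3, h4, h5]
  abel

end Momentum

/-! ## Joint smoothness in space–time -/

section SpaceTime

variable {S : Set ℝ} {ε : ℝ}

omit [DecidableEq d] in
/-- Joint smoothness of tensor fields is componentwise (columns). [folklore] -/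
theorem isSmoothSpaceTimeOn_tensor_iff {R : ℝ → UnitAddTorus d → d → EuclideanSpace ℝ d} :
    FunctionSpaces.Torus.IsSmoothSpaceTimeOn S R ↔ ∀ j, FunctionSpaces.Torus.IsSmoothSpaceTimeOn S (fun t x => R t x j) :=
  contDiffOn_pi

omit [DecidableEq d] in
/-- Joint smoothness of vector fields is componentwise. [folklore] -/
theorem isSmoothSpaceTimeOn_euclidean_iff {v : ℝ → UnitAddTorus d → EuclideanSpace ℝ d} :
    FunctionSpaces.Torus.IsSmoothSpaceTimeOn S v ↔ ∀ j, FunctionSpaces.Torus.IsSmoothSpaceTimeOn S (fun t x => v t x j) :=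
  contDiffOn_piLp (p := 2)

omit [DecidableEq d] in
/-- The tensor product of jointly smooth fields is jointly smooth. [folklore] -/
theorem _root_.Literature.Analysis.FunctionSpaces.Torus.IsSmoothSpaceTimeOn.tensorProd
    {u w : ℝ → UnitAddTorus d → EuclideanSpace ℝ d} (hu : FunctionSpaces.Torus.IsSmoothSpaceTimeOn S u) (hw : FunctionSpaces.Torus.IsSmoothSpaceTimeOn S w) :
    FunctionSpaces.Torus.IsSmoothSpaceTimeOn S (fun t => tensorProd (u t) (w t)) :=
  isSmoothSpaceTimeOn_tensor_iff.2 fun j => (hw.apply j).smul hu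

omit [DecidableEq d] in
/-- The trace of a jointly smooth tensor field is jointly smooth. [folklore] -/
theorem _root_.Literature.Analysis.FunctionSpaces.Torus.IsSmoothSpaceTimeOn.tensorTrace
    {R : ℝ → UnitAddTorus d → d → EuclideanSpace ℝ d} (hR : FunctionSpaces.Torus.IsSmoothSpaceTimeOn S R) :
    FunctionSpaces.Torus.IsSmoothSpaceTimeOn S (fun t => tensorTrace (R t)) :=
  FunctionSpaces.Torus.IsSmoothSpaceTimeOn.sum fun i _ => (hR.column i).apply i

/-- The traceless part of a jointly smooth tensor field is jointly smooth. [folklore] -/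
theorem _root_.Literature.Analysis.FunctionSpaces.Torus.IsSmoothSpaceTimeOn.traceless
    {R : ℝ → UnitAddTorus d → d → EuclideanSpace ℝ d} (hR : FunctionSpaces.Torus.IsSmoothSpaceTimeOn S R) :
    FunctionSpaces.Torus.IsSmoothSpaceTimeOn S (fun t => traceless (R t)) :=
  isSmoothSpaceTimeOn_tensor_iff.2 fun j => (hR.column j).sub
    ((ContDiffOn.div_const hR.tensorTrace _).smul
      (FunctionSpaces.Torus.isSmoothSpaceTimeOn_const (FunctionSpaces.Torus.isSmooth_const _) S))

omit [DecidableEq d] in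
/-- Slice-wise mollification of a jointly smooth *real* field by the standard kernel is jointly
smooth (convex time sets with nonempty interior; `TorusSpaceTimeKernel`). [folklore] -/
theorem _root_.Literature.Analysis.FunctionSpaces.Torus.IsSmoothSpaceTimeOn.kernel_convolution
    {F : Type*} [NormedAddCommGroup F] [NormedSpace ℝ F] (hε : 0 < ε) (hε' : ε ≤ 1 / 4)
    (hS : Convex ℝ S) (hSi : (interior S).Nonempty) {g : ℝ → UnitAddTorus d → F}
    (hg : FunctionSpaces.Torus.IsSmoothSpaceTimeOn S g) : FunctionSpaces.Torus.IsSmoothSpaceTimeOn S (fun t => kernel ε ⋆ g t) :=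
  hg.convolution (FunctionSpaces.Torus.continuous_kernel hε hε').integrable_unitAddTorus hS hSi

omit [DecidableEq d] in
/-- The commutator tensor of a jointly smooth field is jointly smooth (`0 < ε ≤ 1/4`, convex
time set with nonempty interior). [folklore] -/
theorem _root_.Literature.Analysis.FunctionSpaces.Torus.IsSmoothSpaceTimeOn.mollTensorCommutator
    (hε : 0 < ε) (hε' : ε ≤ 1 / 4) (hS : Convex ℝ S) (hSi : (interior S).Nonempty)
    {v : ℝ → UnitAddTorus d → EuclideanSpace ℝ d} (hv : FunctionSpaces.Torus.IsSmoothSpaceTimeOn S v) :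
    FunctionSpaces.Torus.IsSmoothSpaceTimeOn S (fun t => mollTensorCommutator ε (v t)) := by
  refine isSmoothSpaceTimeOn_tensor_iff.2 fun j => ?_
  have h1 : FunctionSpaces.Torus.IsSmoothSpaceTimeOn S (fun t => kernel ε ⋆ fun y => v t y j • v t y) :=
    ((hv.apply j).smul hv).kernel_convolution hε hε' hS hSi
  have h2 : FunctionSpaces.Torus.IsSmoothSpaceTimeOn S (fun t x => (kernel ε ⋆ fun y => v t y j) x • (kernel ε ⋆ v t) x) :=
    ((hv.apply j).kernel_convolution hε hε' hS hSi).smul (hv.kernel_convolution hε hε' hS hSi)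
  exact h1.sub h2

end SpaceTime

/-! ## The mollified Euler–Reynolds triple -/

section Mollify

variable {T ε : ℝ} {v : ℝ → UnitAddTorus d → EuclideanSpace ℝ d} {p : ℝ → UnitAddTorus d → ℝ}
  {R : ℝ → UnitAddTorus d → d → EuclideanSpace ℝ d}

omit [DecidableEq d] in
/-- The mollified velocity `v_ℓ = v * ψ_ℓ` (slice-wise in time; BDSV §2.4). [cite: BuckmasterEtAl2018, §2.4] -/
def mollifyVelocity (ε : ℝ) (v : ℝ → UnitAddTorus d → EuclideanSpace ℝ d) : ℝ → UnitAddTorus d → EuclideanSpace ℝ d :=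
  fun t => kernel ε ⋆ v t

/-- The mollified Reynolds stress `R̊_ℓ = R̊ * ψ_ℓ - [(v ⊗̊ v) * ψ_ℓ - v_ℓ ⊗̊ v_ℓ]` (BDSV §2.4,
with the sign of the commutator term forced by (2.10)). [cite: BuckmasterEtAl2018, §2.4] -/
def mollifyStress (ε : ℝ) (v : ℝ → UnitAddTorus d → EuclideanSpace ℝ d) (R : ℝ → UnitAddTorus d → d → EuclideanSpace ℝ d) :
    ℝ → UnitAddTorus d → d → EuclideanSpace ℝ d :=
  fun t x j => (kernel ε ⋆ R t) x j - traceless (mollTensorCommutator ε (v t)) x j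

omit [DecidableEq d] in
/-- The mollified pressure `p_ℓ = p * ψ_ℓ + tr C/d - ⨍ tr C/d` (mean zero; the trace part of the
commutator tensor enters the pressure, BDSV §2.4 (2.10)). [cite: BuckmasterEtAl2018, §2.4 (2.10)] -/
def mollifyPressure (ε : ℝ) (v : ℝ → UnitAddTorus d → EuclideanSpace ℝ d) (p : ℝ → UnitAddTorus d → ℝ) :
    ℝ → UnitAddTorus d → ℝ :=
  fun t x => (kernel ε ⋆ p t) x + tensorTrace (mollTensorCommutator ε (v t)) x / Fintype.card d -
    ∫ y, tensorTrace (mollTensorCommutator ε (v t)) y / Fintype.card d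

omit [DecidableEq d] in
/-- Unfolding lemma for `mollifyVelocity`. [folklore] -/
@[simp]
theorem mollifyVelocity_apply (ε : ℝ) (v : ℝ → UnitAddTorus d → EuclideanSpace ℝ d) (t : ℝ) :
    mollifyVelocity ε v t = kernel ε ⋆ v t := rfl

/-- **Mollifying an Euler–Reynolds triple in space gives an Euler–Reynolds triple** (BDSV §2.4,
(2.10): "`v_ℓ := v_q * ψ_ℓ`, `R̊_ℓ := R̊_q * ψ_ℓ ∓ [(v_q ⊗̊ v_q) * ψ_ℓ - v_ℓ ⊗̊ v_ℓ]` … These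
functions obey the equation `∂ₜv_ℓ + div (v_ℓ ⊗ v_ℓ) + ∇p_ℓ = div R̊_ℓ`, `div v_ℓ = 0`, in view of
(2.2)"), on `[0, T] × T^d` with the standard mollifier at scale `0 < ε ≤ 1/4`: the pressure is
`p_ℓ = p * ψ_ℓ + (tr C - ⨍ tr C)/d`, `C = (v ⊗ v) * ψ_ℓ - v_ℓ ⊗ v_ℓ`, normalised to zero mean.
[cite: BuckmasterEtAl2018, §2.4 (2.10)] -/
theorem IsEulerReynoldsOn.mollify (h : IsEulerReynoldsOn (Icc 0 T) v p R) (hT : 0 < T)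
    (hε : 0 < ε) (hε' : ε ≤ 1 / 4) :
    IsEulerReynoldsOn (Icc 0 T) (mollifyVelocity ε v) (mollifyPressure ε v p) (mollifyStress ε v R) := by
  have hκc : Continuous (kernel (d := d) ε) := FunctionSpaces.Torus.continuous_kernel hε hε'
  have hκ : Integrable (kernel (d := d) ε) volume := hκc.integrable_unitAddTorus
  have hS : Convex ℝ (Icc 0 T) := convex_Icc 0 T
  have hSi : (interior (Icc 0 T)).Nonempty := by rw [interior_Icc]; exact nonempty_Ioo.2 hT
  have hU : UniqueDiffOn ℝ (Icc 0 T) := uniqueDiffOn_Icc hT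
  have hC : FunctionSpaces.Torus.IsSmoothSpaceTimeOn (Icc 0 T) (fun t => mollTensorCommutator ε (v t)) :=
    h.smooth_velocity.mollTensorCommutator hε hε' hS hSi
  have hθst : FunctionSpaces.Torus.IsSmoothSpaceTimeOn (Icc 0 T)
      (fun t x => tensorTrace (mollTensorCommutator ε (v t)) x / Fintype.card d) :=
    ContDiffOn.div_const hC.tensorTrace _
  refine
    { smooth_velocity := h.smooth_velocity.kernel_convolution hε hε' hS hSi
      smooth_pressure := ((h.smooth_pressure.kernel_convolution hε hε' hS hSi).add hθst).sub
        (hθst.integral_const hU hS)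
      smooth_stress := isSmoothSpaceTimeOn_tensor_iff.2 fun j =>
        ((h.smooth_stress.kernel_convolution hε hε' hS hSi).column j).sub (hC.traceless.column j)
      momentum := fun t ht x => ?_
      divFree := fun t ht => (h.divFree t ht).convolution hκ (h.smooth_velocity.isSmooth_slice ht)
      symm := fun t ht x i j => ?_
      traceFree := fun t ht x => ?_
      hasZeroMean_pressure := fun t ht => ?_ }
  · -- momentum
    have hvt : IsSmooth (v t) := h.smooth_velocity.isSmooth_slice ht
    have hpt : IsSmooth (p t) := h.smooth_pressure.isSmooth_slice ht
    have hRt : IsSmooth (R t) := h.smooth_stress.isSmooth_slice ht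
    have key := mollified_momentum_identity hε hε' hvt hpt hRt (h.divFree t ht)
      (h.momentum t ht) x
    unfold mollifyVelocity mollifyStress
    rw [FunctionSpaces.Torus.timeDerivWithin_convolution_Icc hκ hT h.smooth_velocity ht]
    have hgrad : FunctionSpaces.Torus.gradient (mollifyPressure ε v p t) x =
        FunctionSpaces.Torus.gradient (fun y => (kernel ε ⋆ p t) y +
          tensorTrace (mollTensorCommutator ε (v t)) y / Fintype.card d) x :=
      gradient_sub_const _ _ x
    rw [hgrad, key]
  · -- symmetry
    have hvt : IsSmooth (v t) := h.smooth_velocity.isSmooth_slice ht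
    have hRt : IsSmooth (R t) := h.smooth_stress.isSmooth_slice ht
    simp only [mollifyStress, PiLp.sub_apply]
    rw [convolution_apply_tensor hκ hRt.continuous, convolution_apply_tensor hκ hRt.continuous,
      convolution_apply_euclidean hκ (hRt.column i).continuous,
      convolution_apply_euclidean hκ (hRt.column j).continuous,
      show (fun y => R t y i j) = fun y => R t y j i from funext fun y => h.symm t ht y i j,
      traceless_symm (fun i' j' => mollTensorCommutator_symm hε hε' hvt.continuous x i' j') i j]
  · -- trace free
    have hRt : IsSmooth (R t) := h.smooth_stress.isSmooth_slice ht
    simp only [mollifyStress, PiLp.sub_apply, Finset.sum_sub_distrib, sum_traceless_apply_apply,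
      sub_zero]
    have h1 : ∀ i, (kernel ε ⋆ R t) x i i = (kernel ε ⋆ fun y => R t y i i) x := fun i => by
      rw [convolution_apply_tensor hκ hRt.continuous, convolution_apply_euclidean hκ (hRt.column i).continuous]
    simp_rw [h1]
    rw [← FunctionSpaces.Torus.convolution_finset_sum_right hκ _
      (fun i _ => ((hRt.column i).apply i).continuous),
      show (fun y => ∑ i, R t y i i) = fun _ => (0 : ℝ) from funext (h.traceFree t ht)]
    simp [convolution_lsmul]
  · -- zero mean
    have hpt : IsSmooth (p t) := h.smooth_pressure.isSmooth_slice ht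
    have hvt : IsSmooth (v t) := h.smooth_velocity.isSmooth_slice ht
    have hθ : IsSmooth fun y => tensorTrace (mollTensorCommutator ε (v t)) y / Fintype.card d :=
      ContDiff.div_const (hvt.mollTensorCommutator hε hε').tensorTrace _
    have i1 : Integrable (kernel ε ⋆ p t) volume := (FunctionSpaces.Torus.isSmooth_convolution hκ hpt).integrable
    have i2 : Integrable (fun y => tensorTrace (mollTensorCommutator ε (v t)) y / Fintype.card d) volume :=
      hθ.integrable
    unfold FunctionSpaces.Torus.HasZeroMean mollifyPressure
    rw [integral_sub ?_ (integrable_const _), integral_add i1 i2,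
      integral_convolution (ContinuousLinearMap.lsmul ℝ ℝ) hκ hpt.integrable,
      show ∫ y, p t y = 0 from h.hasZeroMean_pressure t ht]
    · simp
    · exact i1.add i2

end Mollify

end Torus

end Literature.Analysis.FluidPDE
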